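import Literature.NumberTheory.EllipticCurves.ZpExtensionRestrictLayerCompositum
import Literature.NumberTheory.EllipticCurves.ZpExtensionRestrictCyclotomic
import Literature.NumberTheory.EllipticCurves.ZpExtensionUnitTwistProofs
import Literature.NumberTheory.IwasawaTheory.ClassicalMuVanishesDescent
import Literature.NumberTheory.NumberFields.NormRelationPushforward
import HarnessLib

set_option autoImplicit false

/-!
# μ-descent along the cyclotomic tower BY NAME: `e_n(L·F_∞/L) ≤ ∑ᵢ e_n(L^{Hᵢ}·F_∞/L^{Hᵢ})` from a norm relation
# of `Gal(L/F)` with `p ∤ d`, hence `(∀ i, μ(L^{Hᵢ}) = 0) ⇒ μ(L) = 0` — the tower identification `(L^H)_n = (L_n)^H`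

Topic `NumberTheory/IwasawaTheory` (namespace = path).  THEOREM-ONLY file (no definition, no named fact, no `sorry`),
written by the literature seat `bsd-potss-conjA-anchor` g11 (cell `bsd-potss`; supports stmt-BirchSwinnertonDyer-19386 /
19413; closes nothing).  It DISCHARGES the «displayed identification of the sub-towers `(L^H)_n = (L_n)^H`» under which
the μ-descent theorem `classicalMuVanishes_of_le_sum` of `ClassicalMuVanishesDescent.lean` (seat g10) was to be applied,
so that the per-layer input is now produced inside the kernel from ONE norm relation of the finite group `Gal(L/F)`:

Setting.  `F` a number field, `κ` a `ℤ_p`-extension of `F` (layers `F_n = κ.layer n ⊆ F̄`), `L/F` finite Galois with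
`κ ∘ res_{F,L}` surjective (`L ∩ F_∞ = F`; e.g. `p ∤ [L : F]`, tree `surjective_comp_absGaloisRestrict_of_not_dvd_finrank`),
`G = Gal(L/F)`, subgroups `Hᵢ ≤ G` carrying a NORM RELATION `d = ∑ᵢ aᵢ N_{Hᵢ} bᵢ` in `ℤ[G]` with `p ∤ d`
([BiasseEtAl2022] Def. 2.1 / §3 (⋆⋆); coefficientwise hypothesis `hrel` as in `ClassGroupNormRelations.lean`), `Eᵢ = L^{Hᵢ}`
(`IntermediateField.fixedField (H i)`), and the restricted towers `κ|_L = κ.restrict L hL` (`L·F_∞/L`),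
`κ|_{Eᵢ} = κ.restrict Eᵢ (hH i)` (`Eᵢ·F_∞/Eᵢ`).

* `isGalois_fieldRange_sup_layer`, `finiteDimensional_fieldRange_sup_layer`, `numberField_fieldRange_sup_layer` — the
  compositum `j(L)·F_n ⊆ F̄` (`j.fieldRange ⊔ κ.layer n`, any `F`-embedding `j`) is a finite Galois extension of `F`
  (fixing subgroup `Gal(F̄/j(L)) ∩ κ⁻¹(pⁿℤ_p)` is normal: `fixingSubgroup_sup`, `InfiniteGalois.normal_iff_isGalois`).
* `classNumberPExp_restrict_le_sum_of_normRelation` — **`e_n(κ|_L) ≤ ∑ᵢ e_n(κ|_{Eᵢ})` for every `n`.**  Proof (Washington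
  §13.1 for the tower, [BiasseEtAl2022] Prop. 3.7 for the layer): with `e = absEmbedding F L` and `L_n := e(L)·F_n ⊆ F̄`,
  the restriction `Γ_F → Gal(L_n/F)` and `Γ_F → Gal(L/F)` (`absGaloisQuot`) have the same kernel ON `κ⁻¹(pⁿℤ_p)`, and
  `κ⁻¹(pⁿℤ_p) → Gal(L/F)` is onto (this is `L ∩ F_∞ = F`), whence an injective section `s : Gal(L/F) ↪ Gal(L_n/F)`
  («lift acting trivially on `F_n`», i.e. `Gal(L_n/F) ≅ Gal(L/F) × ℤ/pⁿ`); the relation is pushed along `s`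
  (`NormRelation.normRelation_map_of_injective`), Prop. 3.7 (`NormRelation.padicValNat_card_classGroup_le_sum_of_normRelation`)
  bounds `v_p h(L_n)` by `∑ᵢ v_p h(L_n^{s(Hᵢ)})`, and `L_n^{s(Hᵢ)} = e(Eᵢ)·F_n` (`InfiniteGalois.restrict_fixedField` +
  Krull–Galois), which is the `n`-th layer of `κ|_{Eᵢ}` (`ZpExtension.natCard_classGroup_layer_restrict_eq`), as `L_n` is
  that of `κ|_L`.
* `classicalMuVanishes_restrict_of_normRelation` — **μ-descent by name**: under Iwasawa's growth theorem (tree fact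
  `iwasawa1959_classNumberPExp_growth`), `(∀ i, ClassicalMuVanishes κ|_{Eᵢ}) → ClassicalMuVanishes κ|_L`
  (`classicalMuVanishes_of_le_sum` with `cᵢ = 1`, `b = 0`).
* `classNumberPExp_eq_of_isCyclotomic`, `classicalMuVanishes_iff_of_isCyclotomic` — two cyclotomic `ℤ_p`-extensions of
  the same field have the same layers (`IsCyclotomic.exists_eq_unitTwist_holds`, `layer_unitTwist`), hence the same `e_n`
  and the same `μ = 0` predicate.
* `classicalMuVanishes_of_isCyclotomic_of_normRelation` — the consumer form: `κ` CYCLOTOMIC on `F`, `p ∤ [L : F]`, a norm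
  relation with `p ∤ d`, and `μ = 0` for every cyclotomic `ℤ_p`-extension of each `Eᵢ = L^{Hᵢ}` (e.g. Ferrero–Washington for
  the abelian `Eᵢ`, Iwasawa 1956 / Fukuda 1994 certificates for the others) ⇒ `μ = 0` for EVERY cyclotomic `ℤ_p`-extension
  of `L` — the hypothesis `∀ κL : ZpExtension L p, κL.IsCyclotomic → ClassicalMuVanishes κL` of
  `CoatesSujatha2005.thm34_fineSelmerDual_moduleFinite_of_classicalMuVanishes_divisionField` (road (b) of the residue
  cruxes `WildCoatesSujathaResidue` / `TameCoatesSujathaResidue` of the cell `bsd-potss`).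

What stays displayed per row: the norm relation itself (an explicit, finitely checked identity in `ℤ[Gal(L/F)]`; cell
table `pub/bsd-potss/conjA-anchor/g10/cert/`, transported to `Gal(L/F)` by `NormRelation.normRelation_map_mulEquiv`) and
the `μ = 0` inputs for the subfields (named facts + class-number numerics).

References: [Washington1997] L. Washington, *Introduction to Cyclotomic Fields*, 2nd ed., §13.1 (`ℤ_p`-extensions,
`K_∞L/L` and its layers `LK_n`); [BiasseEtAl2022] J.-F. Biasse, C. Fieker, T. Hofmann, A. Page, *Norm relations and
computational problems in number fields*, J. London Math. Soc. 105 (2022), Def. 2.1, Prop. 3.7; [Lang1990] S. Lang,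
*Cyclotomic Fields I and II*, Ch. 5 §1 Thm. 1.2 (iii) (growth `e_n = μpⁿ + λn + ν`); [RaySujatha2021] §1 eq. (1.1).
-/

noncomputable section

open scoped NumberField

open Field IntermediateField Literature.NumberTheory.GaloisRepresentations Literature.NumberTheory.EllipticCurves
  Literature.NumberTheory.EllipticCurves.ZpExtension Literature.NumberTheory.NumberFields

namespace Literature.NumberTheory.IwasawaTheory

/-! ### §0 A group-theoretic section lemma -/

/-- If `q : G → A` is onto already on a subgroup `K ≤ G` and `q`, `r : G → B` have the same kernel on `K`, then
`r|_K` factors through `q|_K`: there is an injective `s : A → B` with `s (q k) = r k` for `k ∈ K`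
(`s = r|_K ∘ (q|_K)⁻¹` on `K/(K ∩ ker q) ≅ A`). [folklore] -/
private theorem exists_monoidHom_comp_eq {G A B : Type*} [Group G] [Group A] [Group B]
    (K : Subgroup G) (q : G →* A) (r : G →* B)
    (hq : ∀ a : A, ∃ k ∈ K, q k = a) (hker : ∀ k ∈ K, q k = 1 ↔ r k = 1) :
    ∃ s : A →* B, Function.Injective s ∧ ∀ k ∈ K, s (q k) = r k := by
  set qK : K →* A := q.comp K.subtype with hqK_def
  set rK : K →* B := r.comp K.subtype with hrK_def
  have hqK : Function.Surjective qK := fun a => by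
    obtain ⟨k, hk, e⟩ := hq a
    exact ⟨⟨k, hk⟩, e⟩
  have hkers : qK.ker = rK.ker := by
    ext ⟨k, hk⟩
    rw [MonoidHom.mem_ker, MonoidHom.mem_ker]
    exact hker k hk
  let e1 : K ⧸ qK.ker ≃* A := QuotientGroup.quotientKerEquivOfSurjective qK hqK
  let e2 : K ⧸ qK.ker ≃* K ⧸ rK.ker := QuotientGroup.quotientMulEquivOfEq hkers
  refine ⟨(QuotientGroup.kerLift rK).comp (e2.toMonoidHom.comp e1.symm.toMonoidHom),
    (QuotientGroup.kerLift_injective rK).comp (e2.injective.comp e1.symm.injective), fun k hk => ?_⟩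
  have h1 : e1.symm (q k) = (QuotientGroup.mk ⟨k, hk⟩ : K ⧸ qK.ker) := by
    rw [MulEquiv.symm_apply_eq]
    rfl
  show QuotientGroup.kerLift rK (e2 (e1.symm (q k))) = r k
  rw [h1, QuotientGroup.quotientMulEquivOfEq_mk, QuotientGroup.kerLift_mk]
  rfl

variable {F : Type} [Field F] [NumberField F] {p : ℕ} [Fact p.Prime]

/-! ### §1 The compositum `j(L)·F_n ⊆ F̄` is a finite Galois extension of `F` -/

/-- **`j(L)·F_n / F` is Galois** for `L/F` Galois and any `F`-embedding `j : L → F̄`: its fixing subgroup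
`Gal(F̄/j(L)) ∩ Gal(F̄/F_n)` (`fixingSubgroup_sup`) is normal (both `j(L) ≅ L` and `F_n` are normal over `F`;
`InfiniteGalois.normal_iff_isGalois`).  Washington §13.1: `K_nL/K` in the tower `K_∞L`. [cite: Washington1997, §13.1] -/
theorem isGalois_fieldRange_sup_layer (κ : ZpExtension F p) (L : Type) [Field L] [Algebra F L] [IsGalois F L]
    (j : L →ₐ[F] AlgebraicClosure F) (n : ℕ) : IsGalois F ↥(j.fieldRange ⊔ κ.layer n) := by
  haveI : IsGalois F (AlgebraicClosure F) := IsAlgClosure.isGalois F _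
  haveI hN : Normal F ↥j.fieldRange := Normal.of_algEquiv (AlgEquiv.ofInjectiveField j)
  haveI : IsGalois F ↥(κ.layer n) := κ.isGalois_layer_holds n
  have h1 : (j.fieldRange.fixingSubgroup).Normal := by
    rw [← IntermediateField.restrictNormalHom_ker]
    exact MonoidHom.normal_ker _
  have h2 : ((κ.layer n).fixingSubgroup).Normal := by
    rw [← IntermediateField.restrictNormalHom_ker]
    exact MonoidHom.normal_ker _
  rw [← InfiniteGalois.normal_iff_isGalois, IntermediateField.fixingSubgroup_sup]
  infer_instance

/-- `j(L)·F_n / F` is finite (`[j(L) : F] = [L : F]`, `[F_n : F] = pⁿ`). [cite: Washington1997, §13.1] -/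
theorem finiteDimensional_fieldRange_sup_layer (κ : ZpExtension F p) (L : Type) [Field L] [Algebra F L]
    [FiniteDimensional F L] (j : L →ₐ[F] AlgebraicClosure F) (n : ℕ) :
    FiniteDimensional F ↥(j.fieldRange ⊔ κ.layer n) := by
  haveI : FiniteDimensional F ↥j.fieldRange := (AlgEquiv.ofInjectiveField j).toLinearEquiv.finiteDimensional
  haveI : FiniteDimensional F ↥(κ.layer n) := κ.finiteDimensional_layer_holds n
  exact IntermediateField.finiteDimensional_sup _ _

/-- `j(L)·F_n` is a number field. [cite: Washington1997, §13.1] -/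
theorem numberField_fieldRange_sup_layer (κ : ZpExtension F p) (L : Type) [Field L] [Algebra F L]
    [FiniteDimensional F L] (j : L →ₐ[F] AlgebraicClosure F) (n : ℕ) :
    NumberField ↥(j.fieldRange ⊔ κ.layer n) := by
  haveI := finiteDimensional_fieldRange_sup_layer κ L j n
  haveI : FiniteDimensional ℚ ↥(j.fieldRange ⊔ κ.layer n) := Module.Finite.trans F _
  exact NumberField.mk

/-! ### §2 The per-layer inequality `e_n(L·F_∞/L) ≤ ∑ᵢ e_n(Eᵢ·F_∞/Eᵢ)` -/

omit [NumberField F] in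
/-- `Gal(F̄/e(E)) = {τ : τ̄ ∈ Gal(L/E)}` for `E = L^H ⊆ L` embedded by `e = absEmbedding F L`: `τ` fixes `e(E)` pointwise
iff its image `τ̄ = absGaloisQuot τ ∈ Gal(L/F)` lies in `H` (`e (τ̄ x) = τ • e x`, finite Galois correspondence
`fixingSubgroup (fixedField H) = H`). [cite: Washington1997, §13.1] -/
private theorem map_comap_absGaloisQuot_eq_fixingSubgroup (L : Type) [Field L] [Algebra F L] [IsGalois F L]
    [FiniteDimensional F L] (H : Subgroup (L ≃ₐ[F] L)) :
    (H.comap (absGaloisQuot F L)).map (absoluteGaloisGroup.toAlgEquiv F).toMonoidHom =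
      (IntermediateField.map (absEmbedding F L) (fixedField H)).fixingSubgroup := by
  ext g
  rw [Subgroup.mem_map_equiv, Subgroup.mem_comap, IntermediateField.mem_fixingSubgroup_iff,
    ← IntermediateField.fixingSubgroup_fixedField H, IntermediateField.mem_fixingSubgroup_iff,
    IntermediateField.fixingSubgroup_fixedField H]
  constructor
  · rintro h y ⟨x, hx, rfl⟩
    have := absEmbedding_absGaloisQuot_apply F L ((absoluteGaloisGroup.toAlgEquiv F).symm g) x
    rw [h x hx] at this
    -- `e x = g⁻¹… ` : `this : e x = (toAlgEquiv.symm g) • e x`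
    exact this.symm
  · intro h x hx
    apply (absEmbedding F L).injective
    change absEmbedding F L (absGaloisQuot F L _ x) = absEmbedding F L x
    rw [absEmbedding_absGaloisQuot_apply]
    exact h _ ⟨x, hx, rfl⟩

/-- **The per-layer inequality `e_n(κ|_L) ≤ ∑ᵢ e_n(κ|_{L^{Hᵢ}})`.**  `L/F` finite Galois with `κ ∘ res` surjective
(`L ∩ F_∞ = F`), `Hᵢ ≤ Gal(L/F)` carrying a norm relation `d = ∑ᵢ aᵢ N_{Hᵢ} bᵢ` with `p ∤ d` ([BiasseEtAl2022] §3 (⋆⋆),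
coefficientwise `hrel`).  Then for every `n` the `p`-parts of the class numbers of the `n`-th layers satisfy
`ord_p h((L·F_∞)_n) ≤ ∑ᵢ ord_p h((L^{Hᵢ}·F_∞)_n)`: the `n`-th layer of `L·F_∞/L` is `L·F_n`, Galois over `F` with
`Gal(L·F_n/F) ≅ Gal(L/F) × Gal(F_n/F)` (Washington §13.1), the relation pushed along `Gal(L/F) ↪ Gal(L·F_n/F)` is a norm
relation of `Gal(L·F_n/F)` w.r.t. the `Hᵢ × 1`, whose fixed fields are the `L^{Hᵢ}·F_n = (L^{Hᵢ}·F_∞)_n`, and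
[BiasseEtAl2022] Prop. 3.7 bounds `v_p h(L·F_n)`. [cite: BiasseEtAl2022, Prop. 3.7] [cite: Washington1997, §13.1] -/
theorem classNumberPExp_restrict_le_sum_of_normRelation (κ : ZpExtension F p) (L : Type) [Field L] [NumberField L]
    [Algebra F L] [IsGalois F L] [Fintype (L ≃ₐ[F] L)] [DecidableEq (L ≃ₐ[F] L)]
    (hL : Function.Surjective (κ.toContinuousMonoidHom.comp (absGaloisRestrict F L)))
    {ι : Type} [Fintype ι] (H : ι → Subgroup (L ≃ₐ[F] L)) [∀ i, Fintype (H i)]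
    (a b : ι → (L ≃ₐ[F] L) → ℤ) {d : ℕ} (hpd : ¬ p ∣ d)
    (hrel : ∀ g : L ≃ₐ[F] L,
      (∑ i, ∑ x : L ≃ₐ[F] L, ∑ h : H i, a i x * b i ((h : L ≃ₐ[F] L)⁻¹ * x⁻¹ * g)) =
        if g = 1 then (d : ℤ) else 0)
    (hH : ∀ i, Function.Surjective
      (κ.toContinuousMonoidHom.comp (absGaloisRestrict F ↥(fixedField (H i)))))
    (n : ℕ) :
    classNumberPExp (κ.restrict L hL) n ≤
      ∑ i, classNumberPExp (κ.restrict ↥(fixedField (H i)) (hH i)) n := by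
  classical
  haveI : FiniteDimensional F L := Module.Finite.of_restrictScalars_finite ℚ F L
  haveI : IsGalois F (AlgebraicClosure F) := IsAlgClosure.isGalois F _
  -- the layer `L_n = e(L)·F_n ⊆ F̄`
  set e : L →ₐ[F] AlgebraicClosure F := absEmbedding F L with he
  set Ln : IntermediateField F (AlgebraicClosure F) := e.fieldRange ⊔ κ.layer n with hLn
  haveI : IsGalois F ↥Ln := isGalois_fieldRange_sup_layer κ L e n
  haveI : FiniteDimensional F ↥Ln := finiteDimensional_fieldRange_sup_layer κ L e n
  haveI : NumberField ↥Ln := numberField_fieldRange_sup_layer κ L e n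
  -- `Γ_F → Gal(L/F)` and `Γ_F → Gal(L_n/F)`
  set q : absoluteGaloisGroup F →* (L ≃ₐ[F] L) := absGaloisQuot F L with hq
  set rn : absoluteGaloisGroup F →* (↥Ln ≃ₐ[F] ↥Ln) :=
    (AlgEquiv.restrictNormalHom ↥Ln).comp (absoluteGaloisGroup.toAlgEquiv F).toMonoidHom with hrn
  have hrange : (absGaloisRestrict F L).range = (e.fieldRange.fixingSubgroup : Subgroup (absoluteGaloisGroup F)) :=
    range_absGaloisRestrict_eq_fixingSubgroup_absEmbedding F L
  have hKn : (κ.layer n).fixingSubgroup = (κ.layerSubgroup n).map (absoluteGaloisGroup.toAlgEquiv F).toMonoidHom :=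
    κ.fixingSubgroup_layer n
  -- `κ⁻¹(pⁿℤ_p) → Gal(L/F)` is onto (`L ∩ F_∞ = F`)
  have hlift : ∀ g : L ≃ₐ[F] L, ∃ σ ∈ κ.layerSubgroup n, q σ = g := by
    intro g
    obtain ⟨σ₀, hσ₀⟩ := absGaloisQuot_surjective F L g
    obtain ⟨τ, hτ⟩ := hL (κ σ₀)
    have hτ' : κ (absGaloisRestrict F L τ) = κ σ₀ := hτ
    refine ⟨σ₀ * (absGaloisRestrict F L τ)⁻¹, ?_, ?_⟩
    · rw [mem_layerSubgroup, map_mul, map_inv, hτ', mul_inv_cancel, toAdd_one]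
      exact dvd_zero _
    · rw [map_mul, map_inv, hσ₀, hq, absGaloisQuot_absGaloisRestrict, inv_one, mul_one]
  -- same kernel on `κ⁻¹(pⁿℤ_p)`
  have hker : ∀ σ ∈ κ.layerSubgroup n, q σ = 1 ↔ rn σ = 1 := by
    intro σ hσ
    rw [hq, absGaloisQuot_eq_one_iff, hrange]
    have h2 : rn σ = 1 ↔ absoluteGaloisGroup.toAlgEquiv F σ ∈ Ln.fixingSubgroup := by
      rw [← IntermediateField.restrictNormalHom_ker, MonoidHom.mem_ker]
      rfl
    rw [h2, hLn, IntermediateField.fixingSubgroup_sup, Subgroup.mem_inf, hKn]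
    constructor
    · intro h1
      exact ⟨h1, Subgroup.mem_map_of_mem _ hσ⟩
    · intro h1
      exact h1.1
  obtain ⟨s, hs_inj, hs⟩ := exists_monoidHom_comp_eq (κ.layerSubgroup n) q rn hlift hker
  -- push the relation along `s` and apply [BiasseEtAl2022] Prop. 3.7 to `L_n / F`
  have hrel' := NormRelation.normRelation_map_of_injective s hs_inj H a b d hrel
  have main := NormRelation.padicValNat_card_classGroup_le_sum_of_normRelation F ↥Ln (fun i => (H i).map s)
    _ _ hpd hrel'
  -- identify the left-hand side: `(L·F_∞)_n ≅ e(L)·F_n = L_n`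
  have hleft : classNumberPExp (κ.restrict L hL) n = padicValNat p (Nat.card (ClassGroup (𝓞 ↥Ln))) := by
    rw [classNumberPExp_def, natCard_classGroup_layer_restrict_eq κ L hL e n]
  -- identify the right-hand side: `L_n^{s(Hᵢ)} = e(Eᵢ)·F_n ≅ (Eᵢ·F_∞)_n`
  have hright : ∀ i, padicValNat p (Nat.card (ClassGroup (𝓞 ↥(fixedField ((H i).map s))))) =
      classNumberPExp (κ.restrict ↥(fixedField (H i)) (hH i)) n := by
    intro i
    -- Step A: `s(Hᵢ) = rn (q⁻¹(Hᵢ) ∩ κ⁻¹(pⁿ))`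
    have hA : (H i).map s = ((H i).comap q ⊓ κ.layerSubgroup n).map rn := by
      ext g
      constructor
      · rintro ⟨h, hh, rfl⟩
        obtain ⟨σ, hσK, hσ⟩ := hlift h
        refine ⟨σ, Subgroup.mem_inf.mpr ⟨?_, hσK⟩, ?_⟩
        · rw [Subgroup.mem_comap, hσ]; exact hh
        · rw [← hs σ hσK, hσ]
      · rintro ⟨σ, hσ, rfl⟩
        obtain ⟨hσH, hσK⟩ := Subgroup.mem_inf.mp hσ
        exact ⟨q σ, hσH, hs σ hσK⟩
    -- Step B–D: its fixed field in `L_n` is `e(Eᵢ)·F_n`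
    set S : Subgroup (AlgebraicClosure F ≃ₐ[F] AlgebraicClosure F) :=
      ((H i).comap q ⊓ κ.layerSubgroup n).map (absoluteGaloisGroup.toAlgEquiv F).toMonoidHom with hS
    have hSmap : S.map (AlgEquiv.restrictNormalHom ↥Ln) = (H i).map s := by
      rw [hA, hS, Subgroup.map_map]
    have hSfix : fixedField S = IntermediateField.map e (fixedField (H i)) ⊔ κ.layer n := by
      rw [hS, Subgroup.map_inf_eq _ _ _ (fun _ _ h => (absoluteGaloisGroup.toAlgEquiv F).injective h),
        map_comap_absGaloisQuot_eq_fixingSubgroup L (H i), ← hKn, ← IntermediateField.fixingSubgroup_sup,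
        InfiniteGalois.fixedField_fixingSubgroup]
    have hle : IntermediateField.map e (fixedField (H i)) ⊔ κ.layer n ≤ Ln := by
      refine sup_le_sup_right ?_ _
      rw [AlgHom.fieldRange_eq_map]
      exact IntermediateField.map_mono e le_top
    have hlift_eq : IntermediateField.lift (fixedField ((H i).map s)) =
        IntermediateField.map e (fixedField (H i)) ⊔ κ.layer n := by
      rw [← hSmap, ← InfiniteGalois.restrict_fixedField S Ln, hSfix]
      exact inf_eq_left.mpr hle
    -- Step E: class numbers along `L_n^{s Hᵢ} ≅ lift ≅ e(Eᵢ)·F_n ≅ (Eᵢ·F_∞)_n`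
    have e₁ : ↥(fixedField ((H i).map s)) ≃ₐ[F] ↥(IntermediateField.map e (fixedField (H i)) ⊔ κ.layer n) :=
      (IntermediateField.liftAlgEquiv (fixedField ((H i).map s))).trans (IntermediateField.equivOfEq hlift_eq)
    have h2 := natCard_classGroup_layer_restrict_eq κ ↥(fixedField (H i)) (hH i) (e.comp (fixedField (H i)).val) n
    rw [IntermediateField.fieldRange_comp_val] at h2
    rw [classNumberPExp_def, h2]
    exact congrArg (padicValNat p)
      (Nat.card_congr (ClassGroup.mulEquiv (NumberField.RingOfIntegers.mapRingEquiv e₁.toRingEquiv)).toEquiv)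
  rw [hleft, ← Finset.sum_congr rfl fun i _ => hright i]
  exact main

/-! ### §3 μ-descent by name -/

/-- **μ-descent along the cyclotomic tower, by name.**  `F` a number field, `κ` a `ℤ_p`-extension of `F`, `L/F` finite
Galois with `κ ∘ res` surjective, `Hᵢ ≤ Gal(L/F)` carrying a norm relation with `p ∤ d` ([BiasseEtAl2022] Def. 2.1).  If the
restricted tower `L^{Hᵢ}·F_∞/L^{Hᵢ}` has `μ = 0` (growth form `ClassicalMuVanishes`) for every `i`, then — under Iwasawa's
growth theorem, tree fact `iwasawa1959_classNumberPExp_growth` — so does `L·F_∞/L`: the per-layer inequality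
`classNumberPExp_restrict_le_sum_of_normRelation` fed to `classicalMuVanishes_of_le_sum`.
[cite: BiasseEtAl2022, Prop. 3.7] [cite: Lang1990, Ch. 5 §1 Thm. 1.2 (iii) (pp. 124–129)] [cite: Washington1997, §13.1] -/
theorem classicalMuVanishes_restrict_of_normRelation (hI : iwasawa1959_classNumberPExp_growth)
    (κ : ZpExtension F p) (L : Type) [Field L] [NumberField L] [Algebra F L] [IsGalois F L]
    [Fintype (L ≃ₐ[F] L)] [DecidableEq (L ≃ₐ[F] L)]
    (hL : Function.Surjective (κ.toContinuousMonoidHom.comp (absGaloisRestrict F L)))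
    {ι : Type} [Fintype ι] (H : ι → Subgroup (L ≃ₐ[F] L)) [∀ i, Fintype (H i)]
    (a b : ι → (L ≃ₐ[F] L) → ℤ) {d : ℕ} (hpd : ¬ p ∣ d)
    (hrel : ∀ g : L ≃ₐ[F] L,
      (∑ i, ∑ x : L ≃ₐ[F] L, ∑ h : H i, a i x * b i ((h : L ≃ₐ[F] L)⁻¹ * x⁻¹ * g)) =
        if g = 1 then (d : ℤ) else 0)
    (hH : ∀ i, Function.Surjective
      (κ.toContinuousMonoidHom.comp (absGaloisRestrict F ↥(fixedField (H i)))))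
    (hμ : ∀ i, ClassicalMuVanishes (κ.restrict ↥(fixedField (H i)) (hH i))) :
    ClassicalMuVanishes (κ.restrict L hL) := by
  refine classicalMuVanishes_of_le_sum hI (κ.restrict L hL)
    (κs := fun i => κ.restrict ↥(fixedField (H i)) (hH i)) (c := fun _ => 1) (b := 0) (n₀ := 0)
    (fun n _ => ?_) hμ
  simpa only [one_mul, add_zero] using
    classNumberPExp_restrict_le_sum_of_normRelation κ L hL H a b hpd hrel hH n

/-! ### §4 Independence of the normalisation of the cyclotomic tower; the consumer form -/

/-- Two cyclotomic `ℤ_p`-extensions of the same field have the same `e_n` (they differ by a unit twist,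
`IsCyclotomic.exists_eq_unitTwist_holds`, and unit twists do not move the layers, `layer_unitTwist`).
[cite: Washington1997, §13.1] -/
theorem classNumberPExp_eq_of_isCyclotomic {K : Type} [Field K] (κ₁ κ₂ : ZpExtension K p)
    (h₁ : κ₁.IsCyclotomic) (h₂ : κ₂.IsCyclotomic) (n : ℕ) :
    classNumberPExp κ₁ n = classNumberPExp κ₂ n := by
  obtain ⟨u, hu⟩ := ZpExtension.IsCyclotomic.exists_eq_unitTwist_holds h₁ h₂
  rw [hu]
  exact (congrArg (fun E : IntermediateField K (AlgebraicClosure K) => padicValNat p (Nat.card (ClassGroup (𝓞 ↥E))))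
    (κ₁.layer_unitTwist u n)).symm

/-- Hence the `μ = 0` predicate does not depend on the normalisation `Gal(K_∞^{cyc}/K) ≃ ℤ_p`. [cite: Washington1997, §13.1]
[cite: RaySujatha2021, §1 eq. (1.1)] -/
theorem classicalMuVanishes_iff_of_isCyclotomic {K : Type} [Field K] (κ₁ κ₂ : ZpExtension K p)
    (h₁ : κ₁.IsCyclotomic) (h₂ : κ₂.IsCyclotomic) :
    ClassicalMuVanishes κ₁ ↔ ClassicalMuVanishes κ₂ := by
  simp only [ClassicalMuVanishes, classNumberPExp_eq_of_isCyclotomic κ₁ κ₂ h₁ h₂]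

omit [Fact p.Prime] in
/-- `p ∤ [L^{H} : F]` when `p ∤ [L : F]` (tower law). [cite: Washington1997, §13.1] -/
private theorem not_dvd_finrank_fixedField (L : Type) [Field L] [Algebra F L] [FiniteDimensional F L]
    (hp : ¬ p ∣ Module.finrank F L) (H : Subgroup (L ≃ₐ[F] L)) :
    ¬ p ∣ Module.finrank F ↥(fixedField H) := fun h =>
  hp (h.trans (Dvd.intro _ (Module.finrank_mul_finrank F ↥(fixedField H) L)))

/-- **Consumer form (μ-descent for the cyclotomic towers).**  `κ` the cyclotomic `ℤ_p`-extension of a number field `F`,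
`L/F` finite Galois with `p ∤ [L : F]`, `Hᵢ ≤ Gal(L/F)` carrying a norm relation `d = ∑ᵢ aᵢ N_{Hᵢ} bᵢ` with `p ∤ d`
([BiasseEtAl2022] Def. 2.1; coefficientwise `hrel`).  If `μ = 0` holds for every cyclotomic `ℤ_p`-extension of each
`Eᵢ = L^{Hᵢ}` (Ferrero–Washington for abelian `Eᵢ`; Iwasawa 1956 / Fukuda 1994 certificates otherwise), then — under
Iwasawa's growth theorem — `μ = 0` holds for EVERY cyclotomic `ℤ_p`-extension `κL` of `L`
(`κ|_L` is cyclotomic, `isCyclotomic_restrict`; all cyclotomic `κL` share its layers).  This is the hypothesis shape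
`∀ κL, κL.IsCyclotomic → ClassicalMuVanishes κL` of the Coates–Sujatha road (b) of the `bsd-potss` residue cruxes.
[cite: BiasseEtAl2022, Prop. 3.7] [cite: Lang1990, Ch. 5 §1 Thm. 1.2 (iii) (pp. 124–129)] [cite: Washington1997, §13.1] -/
theorem classicalMuVanishes_of_isCyclotomic_of_normRelation (hI : iwasawa1959_classNumberPExp_growth)
    (κ : ZpExtension F p) (hκ : κ.IsCyclotomic) (L : Type) [Field L] [NumberField L] [Algebra F L] [IsGalois F L]
    [Fintype (L ≃ₐ[F] L)] [DecidableEq (L ≃ₐ[F] L)] (hp : ¬ p ∣ Module.finrank F L)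
    {ι : Type} [Fintype ι] (H : ι → Subgroup (L ≃ₐ[F] L)) [∀ i, Fintype (H i)]
    (a b : ι → (L ≃ₐ[F] L) → ℤ) {d : ℕ} (hpd : ¬ p ∣ d)
    (hrel : ∀ g : L ≃ₐ[F] L,
      (∑ i, ∑ x : L ≃ₐ[F] L, ∑ h : H i, a i x * b i ((h : L ≃ₐ[F] L)⁻¹ * x⁻¹ * g)) =
        if g = 1 then (d : ℤ) else 0)
    (hμ : ∀ i, ∀ κE : ZpExtension ↥(fixedField (H i)) p, κE.IsCyclotomic → ClassicalMuVanishes κE)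
    (κL : ZpExtension L p) (hκL : κL.IsCyclotomic) : ClassicalMuVanishes κL := by
  haveI : FiniteDimensional F L := Module.Finite.of_restrictScalars_finite ℚ F L
  have hL := surjective_comp_absGaloisRestrict_of_not_dvd_finrank κ L hp
  have hH : ∀ i, Function.Surjective
      (κ.toContinuousMonoidHom.comp (absGaloisRestrict F ↥(fixedField (H i)))) := fun i =>
    surjective_comp_absGaloisRestrict_of_not_dvd_finrank κ _ (not_dvd_finrank_fixedField L hp (H i))
  have h1 : ClassicalMuVanishes (κ.restrict L hL) :=
    classicalMuVanishes_restrict_of_normRelation hI κ L hL H a b hpd hrel hH fun i =>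
      hμ i _ (isCyclotomic_restrict κ hκ _ (hH i))
  exact (classicalMuVanishes_iff_of_isCyclotomic _ _ (isCyclotomic_restrict κ hκ L hL) hκL).mp h1

end Literature.NumberTheory.IwasawaTheory

end
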